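import Summits.QuantumFields.YangMills.Theorems.FluctuationComparisonRegPrIntLS2BetaChartJacProductRows
import HarnessLib

/-!
# CHART∞ · IV-c″ (LINE g18-1 `semiclassical_s2beta`, organ S2β, DET-REP-B‴∘ ∕ JACW row): THE FIBRED CHART WITH ITS JACOBIAN AS A PRODUCT OVER THE COARSE BONDS —
# the ∃-export carrying the chain data `(T, ϑ, jd)`, ✓IV-b's eighteen rows, the two defining equations and ✓IV-c's twenty rows; ✓IV-c recovered

R3 = Bałaban's UV-stability programme on the finite 3-torus, gauge group `SU(N)` (generic `(P, N)` here) — NOT d = 4, NOT infinite volume, NOT a mass gap,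
NOT Clay; the Yang–Mills gap is NOT proved by anything in this file.  Width seat `ym-ust-20520-w5` g16; helper toward crux `stmt-QuantumFields-20520`
(`--supports … --as helper`); LEAD w3-20520 g17 GO 04:36:41Z.  Sequel of ✓`…S2BetaChartJacProductRows` (IV-c′, the explicit-data re-run of ✓IV-c).

WHAT.  ★★★`exists_fibredChart_iter_cont_blind_prod` — under ✓IV-c's hypotheses: `∃ T ϑ jd Φ Jac` with (i) ✓IV-b
`…S2BetaChartContBlindCharts.exists_chainCharts_cont_blind`'s EIGHTEEN per-bond rows VERBATIM (measurability ×3, the inverse `ϑ` on the image window `T`, the per-bond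
law `Haar⌊chainWindow = (ϑ c U)_*(jd c U · Haar⌊T c U)`, `T` = image window, left inverse, `ϑ` into the window, `T` closed, `ContinuousOn` of `ϑ`∕`jd` on `T`, `jd ≠ 0` on `T`,
`j₀^n·jd ≤ 1`, joint continuity of `ϑ`∕`jd` on the guarded window graph, PIVOT-BLINDNESS of `T`∕`ϑ`∕`jd`), (ii) the DEFINING EQUATIONS `Φ = (V,z) ↦ z[βₙc ↦ ϑ c z (V c)]`,
`Jac = 1_{∀ c, V c ∈ T c z}·Π_c jd c z (V c)` — ONE factor per COARSE bond `c : PBond P n`, and (iii) ✓IV-c's TWENTY rows for `(Φ, Jac, T)` VERBATIM.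
(✓IV-c's statement is recovered from it by the projection `⟨Φ, Jac, T, rows⟩` — kept as a HOME certificate, not a tree theorem: a verbatim restatement of a landed
declaration is refused by the gate's `dedup.landed`.)
★`jac_apply_eq_prod_of_mem` ∕ ★`coe_jac_apply_eq_prod_of_mem` ∕ ★★`log_jac_apply_eq_sum_log_of_mem` — on the windows `Jac (V,z) = Π_c jd c z (V c)` (in `ℝ≥0`, in `ℝ`) and
`log Jac (V,z) = Σ_c log (jd c z (V c))`: the LOCAL-SUM representation that ✓p761050 `…S2BetaLocalSumFourPointOneSided` consumes for the JACW-ROW (FINDING #41 §2).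
HONEST SCOPE.  Packaging of landed theorems; nothing new about the tower is proved; the JACW hand still owes (J-PIN) (pinning an arbitrary chart-with-rows to this
`Jac`), (J-LIP) and (J-BRD); DET-REP-B‴∘ ∕ LAPLACE ∕ S2β ∕ crux 20520 NOT proved; `YM3TorusSU2` NOT proved.  0 `def`, default heartbeats.
[cite: Balaban1987RG1, (0.4) p.253, (2.4) p.266 and (2.10) p.267]
-/

set_option autoImplicit false

noncomputable section

open MeasureTheory Filter Topology Set
open scoped ENNReal NNReal
open Literature.MathematicalPhysics.QuantumFieldTheory.Balaban1983to89
open Literature.MathematicalPhysics.QuantumFieldTheory.Balaban1983to89.T4Continuum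

namespace Summit.QuantumFields.YangMills.Theorems.FluctuationComparisonRegPrIntLS2BetaChartJacProduct

open Summit.QuantumFields.YangMills.Theorems.FluctuationComparisonRegPrIntLWregChain
open Summit.QuantumFields.YangMills.Theorems.FluctuationComparisonRegPrIntLWregFibredChart
open Summit.QuantumFields.YangMills.Theorems.FluctuationComparisonRegPrIntLS2BetaChartContBlindCharts (exists_chainCharts_cont_blind)
open Summit.QuantumFields.YangMills.Theorems.FluctuationComparisonRegPrIntLS2BetaChartJacProductRows (exists_fibredChart_rows_of_chainData)
open Function
open Literature.MathematicalPhysics.QuantumFieldTheory.Balaban1983to89.BlockAveraging (Idx avgFun measurable_avgFun loopHol)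
open Literature.MathematicalPhysics.QuantumFieldTheory.Balaban1983to89.BlockAveragingHaarAC (centralBond centralBond_injective isLocal_avgFun pre post)
open Literature.MathematicalPhysics.QuantumFieldTheory.Balaban1983to89.BlockAveragingEMLHaarAC (fibreFamily offCard)
open Literature.MathematicalPhysics.QuantumFieldTheory.Balaban1983to89.ExpMeanLog (expMeanLogSU deltaSU deltaSU_pos measurable_expMeanLogSU_E)
open Literature.MathematicalPhysics.QuantumFieldTheory.Balaban1983to89.Node00 (SU)

variable {P : Params} {N : ℕ} [NeZero N]

/-! ## §1 The product identity on the windows (generic in the chain data) -/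

section Product

variable {n : ℕ} {T : PBond P n → GaugeField P 0 (SU N) → Set (SU N)} {jd : PBond P n → GaugeField P 0 (SU N) → SU N → ℝ≥0}
  {Jac : GaugeField P n (SU N) × GaugeField P 0 (SU N) → ℝ≥0}

omit [NeZero N] in
/-- ★ On the windows the Jacobian IS the product: `Jac (V, z) = Π_c jd c z (V c)` when `∀ c, V c ∈ T c z`. [cite: Balaban1987RG1, (2.10) p.267] -/
theorem jac_apply_eq_prod_of_mem
    (hJ : Jac = fun p => {p : GaugeField P n (SU N) × GaugeField P 0 (SU N) | ∀ c, p.1 c ∈ T c p.2}.indicator (fun p => ∏ c, jd c p.2 (p.1 c)) p)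
    {V : GaugeField P n (SU N)} {z : GaugeField P 0 (SU N)} (hV : ∀ c, V c ∈ T c z) : Jac (V, z) = ∏ c, jd c z (V c) := by
  have hVs : ((V, z) : GaugeField P n (SU N) × GaugeField P 0 (SU N)) ∈ {p : GaugeField P n (SU N) × GaugeField P 0 (SU N) | ∀ c, p.1 c ∈ T c p.2} := hV
  rw [hJ]
  exact Set.indicator_of_mem hVs (fun p : GaugeField P n (SU N) × GaugeField P 0 (SU N) => ∏ c, jd c p.2 (p.1 c))

omit [NeZero N] in
/-- Off the windows the Jacobian vanishes. [cite: Balaban1987RG1, (2.10) p.267] -/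
theorem jac_apply_eq_zero_of_not_mem
    (hJ : Jac = fun p => {p : GaugeField P n (SU N) × GaugeField P 0 (SU N) | ∀ c, p.1 c ∈ T c p.2}.indicator (fun p => ∏ c, jd c p.2 (p.1 c)) p)
    {V : GaugeField P n (SU N)} {z : GaugeField P 0 (SU N)} (hV : ¬ ∀ c, V c ∈ T c z) : Jac (V, z) = 0 := by
  have hVs : ((V, z) : GaugeField P n (SU N) × GaugeField P 0 (SU N)) ∉ {p : GaugeField P n (SU N) × GaugeField P 0 (SU N) | ∀ c, p.1 c ∈ T c p.2} := hV
  rw [hJ]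
  exact Set.indicator_of_notMem hVs _

omit [NeZero N] in
/-- ★ The product identity in `ℝ`: `(Jac (V, z) : ℝ) = Π_c (jd c z (V c) : ℝ)` on the windows. [cite: Balaban1987RG1, (2.10) p.267] -/
theorem coe_jac_apply_eq_prod_of_mem
    (hJ : Jac = fun p => {p : GaugeField P n (SU N) × GaugeField P 0 (SU N) | ∀ c, p.1 c ∈ T c p.2}.indicator (fun p => ∏ c, jd c p.2 (p.1 c)) p)
    {V : GaugeField P n (SU N)} {z : GaugeField P 0 (SU N)} (hV : ∀ c, V c ∈ T c z) : (Jac (V, z) : ℝ) = ∏ c, (jd c z (V c) : ℝ) := by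
  rw [jac_apply_eq_prod_of_mem hJ hV, NNReal.coe_prod]

omit [NeZero N] in
/-- ★★ **THE LOCAL-SUM REPRESENTATION OF `log Jac`**: on the windows, with every factor live (`jd c z (V c) ≠ 0`, ✓IV-b's row on `T`),
`log (Jac (V, z)) = Σ_c log (jd c z (V c))` — ONE term per COARSE bond; the input shape of ✓`…S2BetaLocalSumFourPointOneSided.abs_fourPt_sum_le_of_oneSided_site` for the
JACW-ROW. [cite: Balaban1987RG1, (2.10) p.267] -/
theorem log_jac_apply_eq_sum_log_of_mem
    (hJ : Jac = fun p => {p : GaugeField P n (SU N) × GaugeField P 0 (SU N) | ∀ c, p.1 c ∈ T c p.2}.indicator (fun p => ∏ c, jd c p.2 (p.1 c)) p)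
    (hj0 : ∀ c U, ∀ v ∈ T c U, jd c U v ≠ 0)
    {V : GaugeField P n (SU N)} {z : GaugeField P 0 (SU N)} (hV : ∀ c, V c ∈ T c z) :
    Real.log (Jac (V, z) : ℝ) = ∑ c, Real.log (jd c z (V c) : ℝ) := by
  rw [coe_jac_apply_eq_prod_of_mem hJ hV]
  exact Real.log_prod fun c _ => NNReal.coe_ne_zero.2 (hj0 c z _ (hV c))

end Product

/-! ## §2 The ∃-export: chain data, eighteen per-bond rows, the two defining equations, twenty fibred-chart rows -/

/-- ★★★ **THE FIBRED CHART OF THE ITERATED AVERAGING WITH ITS JACOBIAN AS A PRODUCT OVER THE COARSE BONDS** — ✓IV-b's per-bond chain data `(T, ϑ, jd)` with its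
eighteen rows VERBATIM, the chart `Φ` and the Jacobian `Jac` given by their DEFINING EQUATIONS (`Jac (V,z) = 1_{∀ c, V c ∈ T c z}·Π_c jd c z (V c)`), and ✓IV-c
`…S2BetaChartContBlindFibredChart.exists_fibredChart_iter_cont_blind`'s twenty rows VERBATIM (by ✓IV-c′ `exists_fibredChart_rows_of_chainData`).
[cite: Balaban1987RG1, (0.4) p.253, (2.4) p.266 and (2.10) p.267] -/
theorem exists_fibredChart_iter_cont_blind_prod {α : ℝ} (hα0 : 0 ≤ α) (hα24 : α ≤ 1 / 24) (hα64 : 64 * α ≤ deltaSU (Fin N))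
    (hαL : 157 * α < ((P.L : ℝ) ^ (P.d - 1))⁻¹)
    (hgap : ∀ j (c : PBond P (j + 1)), (offCard c : ℝ) / (Fintype.card (Idx P) : ℝ) + 150 * α < 1)
    {j₀ : ℝ≥0} (hvol : j₀ = 0 ∨ ChainVol P N α j₀) {n : ℕ} (hn : n ≤ P.m + P.K) :
    ∃ (T : PBond P n → GaugeField P 0 (SU N) → Set (SU N)) (ϑ : PBond P n → GaugeField P 0 (SU N) → SU N → SU N)
      (jd : PBond P n → GaugeField P 0 (SU N) → SU N → ℝ≥0)
      (Φ : GaugeField P n (SU N) × GaugeField P 0 (SU N) → GaugeField P 0 (SU N)) (Jac : GaugeField P n (SU N) × GaugeField P 0 (SU N) → ℝ≥0), (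
      (∀ c, MeasurableSet {p : GaugeField P 0 (SU N) × SU N | p.2 ∈ T c p.1}) ∧
      (∀ c, Measurable fun p : GaugeField P 0 (SU N) × SU N => ϑ c p.1 p.2) ∧
      (∀ c, Measurable fun p : GaugeField P 0 (SU N) × SU N => jd c p.1 p.2) ∧
      (∀ c U, ∀ v ∈ T c U, chainMap (expMeanLogSU (n := Fin N)) n U c (ϑ c U v) = v) ∧
      (∀ c U, (HaarData.haar : Measure (SU N)).restrict (chainWindow α n U c) =
        (((HaarData.haar : Measure (SU N)).restrict (T c U)).withDensity fun v => (jd c U v : ℝ≥0∞)).map (ϑ c U)) ∧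
      (∀ c U, T c U = chainMap (expMeanLogSU (n := Fin N)) n U c '' chainWindow α n U c) ∧
      (∀ c U, ∀ g ∈ chainWindow α n U c, ϑ c U (chainMap (expMeanLogSU (n := Fin N)) n U c g) = g) ∧
      (∀ c U, ∀ v ∈ T c U, ϑ c U v ∈ chainWindow α n U c) ∧
      (∀ c U, IsClosed (T c U)) ∧
      (∀ c U, ContinuousOn (ϑ c U) (T c U)) ∧
      (∀ c U, ContinuousOn (jd c U) (T c U)) ∧
      (∀ c U, ∀ v ∈ T c U, jd c U v ≠ 0) ∧
      (∀ c U, ∀ v ∈ T c U, j₀ ^ n * jd c U v ≤ 1) ∧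
      (∀ c, ContinuousOn (fun p : GaugeField P 0 (SU N) × SU N => ϑ c p.1 p.2)
        {p : GaugeField P 0 (SU N) × SU N |
          (∀ k, k < n → ∀ (c' : PBond P (k + 1)) (i : Idx P),
            dist1 (loopHol (Averaging.iter (fun i => BlockAveraging.blockAvg (P := P) (j := i) (expMeanLogSU (n := Fin N))) k p.1) c' i) ≤ α) ∧
          p.2 ∈ T c p.1}) ∧
      (∀ c, ContinuousOn (fun p : GaugeField P 0 (SU N) × SU N => jd c p.1 p.2)
        {p : GaugeField P 0 (SU N) × SU N |
          (∀ k, k < n → ∀ (c' : PBond P (k + 1)) (i : Idx P),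
            dist1 (loopHol (Averaging.iter (fun i => BlockAveraging.blockAvg (P := P) (j := i) (expMeanLogSU (n := Fin N))) k p.1) c' i) ≤ α) ∧
          p.2 ∈ T c p.1}) ∧
      (∀ c U (g : PBond P n → SU N), T c (extend (iterCentralBond n) g U) = T c U) ∧
      (∀ c U (g : PBond P n → SU N), ∀ v ∈ T c U, ϑ c (extend (iterCentralBond n) g U) v = ϑ c U v) ∧
      (∀ c U (g : PBond P n → SU N), ∀ v ∈ T c U, jd c (extend (iterCentralBond n) g U) v = jd c U v)) ∧
      Φ = (fun p => extend (iterCentralBond n) (fun c => ϑ c p.2 (p.1 c)) p.2) ∧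
      Jac = (fun p => {p : GaugeField P n (SU N) × GaugeField P 0 (SU N) | ∀ c, p.1 c ∈ T c p.2}.indicator (fun p => ∏ c, jd c p.2 (p.1 c)) p) ∧ (
      Measurable Φ ∧ Measurable Jac ∧
      (∀ V z, Jac (V, z) ≠ 0 → Averaging.iter (fun i => BlockAveraging.blockAvg (P := P) (j := i) (expMeanLogSU (n := Fin N))) n (Φ (V, z)) = V) ∧
      (∀ U₀ : Set (GaugeField P n (SU N)), MeasurableSet U₀ →
        (fieldMeasure P 0 (SU N)).restrict
            (Averaging.iter (fun i => BlockAveraging.blockAvg (P := P) (j := i) (expMeanLogSU (n := Fin N))) n ⁻¹' U₀ ∩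
              {U | ∀ c, U (iterCentralBond n c) ∈ chainWindow α n U c}) =
          ((((fieldMeasure P n (SU N)).restrict U₀).prod (fieldMeasure P 0 (SU N))).withDensity fun p => (Jac p : ℝ≥0∞)).map Φ) ∧
      (∀ c z, IsClosed (T c z)) ∧
      (∀ V z, Jac (V, z) ≠ 0 ↔ ∀ c, V c ∈ T c z) ∧
      (∀ V₀ z, (∀ c, V₀ c ∈ interior (T c z)) → ContinuousAt (fun V => Φ (V, z)) V₀ ∧ ContinuousAt (fun V => Jac (V, z)) V₀) ∧
      (∀ V₀ z, (∃ c, V₀ c ∉ closure (T c z)) → ∀ᶠ V in 𝓝 V₀, Jac (V, z) = 0) ∧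
      (∀ c z, T c z = chainMap (expMeanLogSU (n := Fin N)) n z c '' chainWindow α n z c) ∧
      (∀ V z, (∀ c, V c ∈ T c z) → (∀ b, (∀ c, iterCentralBond n c ≠ b) → Φ (V, z) b = z b) ∧
        ∀ c, Φ (V, z) (iterCentralBond n c) ∈ chainWindow α n (Φ (V, z)) c) ∧
      (∀ p, j₀ ^ (n * Fintype.card (PBond P n)) * Jac p ≤ 1) ∧
      (∀ V z (g : PBond P n → SU N), (∀ c, g c ∈ chainWindow α n z c) →
        (∀ c, V c = Averaging.iter (fun i => BlockAveraging.blockAvg (P := P) (j := i) (expMeanLogSU (n := Fin N))) n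
          (extend (iterCentralBond n) g z) c) →
        Jac (V, z) ≠ 0 ∧ Φ (V, z) = extend (iterCentralBond n) g z) ∧
      ContinuousOn Φ {p : GaugeField P n (SU N) × GaugeField P 0 (SU N) |
        (∀ k, k < n → ∀ (c' : PBond P (k + 1)) (i : Idx P),
          dist1 (loopHol (Averaging.iter (fun i => BlockAveraging.blockAvg (P := P) (j := i) (expMeanLogSU (n := Fin N))) k p.2) c' i) ≤ α) ∧
        ∀ c, p.1 c ∈ T c p.2} ∧
      ContinuousOn Jac {p : GaugeField P n (SU N) × GaugeField P 0 (SU N) |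
        (∀ k, k < n → ∀ (c' : PBond P (k + 1)) (i : Idx P),
          dist1 (loopHol (Averaging.iter (fun i => BlockAveraging.blockAvg (P := P) (j := i) (expMeanLogSU (n := Fin N))) k p.2) c' i) ≤ α) ∧
        ∀ c, p.1 c ∈ T c p.2} ∧
      (∀ (V : GaugeField P n (SU N)) (z₀ : GaugeField P 0 (SU N)),
        (∀ k, k < n → ∀ (c' : PBond P (k + 1)) (i : Idx P),
          dist1 (loopHol (Averaging.iter (fun i => BlockAveraging.blockAvg (P := P) (j := i) (expMeanLogSU (n := Fin N))) k z₀) c' i) < α) →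
        (∀ c, V c ∈ T c z₀) →
        ContinuousWithinAt Φ {p : GaugeField P n (SU N) × GaugeField P 0 (SU N) | ∀ c, p.1 c ∈ T c p.2} (V, z₀) ∧
        ContinuousWithinAt Jac {p : GaugeField P n (SU N) × GaugeField P 0 (SU N) | ∀ c, p.1 c ∈ T c p.2} (V, z₀)) ∧
      (∀ c z (g : PBond P n → SU N), T c (extend (iterCentralBond n) g z) = T c z) ∧
      (∀ V z (g : PBond P n → SU N), (∀ c, V c ∈ T c z) → Φ (V, extend (iterCentralBond n) g z) = Φ (V, z)) ∧
      (∀ V z (g : PBond P n → SU N), Jac (V, extend (iterCentralBond n) g z) = Jac (V, z)) ∧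
      (∀ (V : GaugeField P n (SU N)) (z₀ : GaugeField P 0 (SU N)), (∀ c, V c ∈ T c z₀) →
        (∀ k, k < n → ∀ (c' : PBond P (k + 1)) (i : Idx P),
          dist1 (loopHol (Averaging.iter (fun i => BlockAveraging.blockAvg (P := P) (j := i) (expMeanLogSU (n := Fin N))) k (Φ (V, z₀))) c' i) < α) →
        ContinuousWithinAt Φ {p : GaugeField P n (SU N) × GaugeField P 0 (SU N) | ∀ c, p.1 c ∈ T c p.2} (V, z₀) ∧
        ContinuousWithinAt Jac {p : GaugeField P n (SU N) × GaugeField P 0 (SU N) | ∀ c, p.1 c ∈ T c p.2} (V, z₀))) := by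
  have hαδ : α < deltaSU (Fin N) := by nlinarith [deltaSU_pos (n := Fin N)]
  obtain ⟨T, ϑ, jd, h⟩ := exists_chainCharts_cont_blind (N := N) (P := P) hα0 hα24 hα64 hαL hgap hvol hn
  obtain ⟨Φ, Jac, hΦ, hJ, hC⟩ := exists_fibredChart_rows_of_chainData (N := N) (P := P) hαδ hn T ϑ jd h
  exact ⟨T, ϑ, jd, Φ, Jac, h, hΦ, hJ, hC⟩

-- §3 (✓IV-c RECOVERED) is NOT a tree theorem: `exists_fibredChart_iter_cont_blind_of_prod : ⟨✓IV-c's statement VERBATIM⟩ :=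
--   by obtain ⟨T, ϑ, jd, Φ, Jac, -, -, -, hC⟩ := exists_fibredChart_iter_cont_blind_prod …; exact ⟨Φ, Jac, T, hC⟩`
-- restates a landed declaration (gate `dedup.landed`), so it lives in the HOME certificate `ym-ust-20520-w5/g16/COMBINED-A-B.w5g16.lean` (farm rc 0; px20 g10's
-- letter-fit 3672 ch == 3672 ch) — the inclusion «IV-c″ ⊇ IV-c» is that two-line projection.

end Summit.QuantumFields.YangMills.Theorems.FluctuationComparisonRegPrIntLS2BetaChartJacProduct

end
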